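import Summits.ResolutionOfSingularities.ResolutionOfSingularities.Theorems.HilbertSamuelEliminationSigmaMaxModificationsCorridor3SigmaStepDefs
import HarnessLib

/-!
# [OURS · L1 W4.2] σ-LAYER part 1b — `Corridor3SigmaCycleDefs`: CYCLE-DISCIPLINED strategies («SHAPE (3)») inside the σ-layer

Crux chain w42 (`SigmaMaxModifications`, stmt-ResolutionOfSingularities-18506; conjunct `SigmaMaxModificationsCorridor3`,
stmt-ResolutionOfSingularities-19249), res-L1-w42-plan-1 RULINGS v3.14-6 (BQ) (2026-08-27 09:36:02Z): «047's GENERAL `Sigma.Strategy` is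
the VOCABULARY layer; 040's SHAPE (3) = the CLASS of cycle-disciplined strategies inside it». Typer res-type-040 (gen 18); part 1 =
res-D-pv-047's `…Corridor3SigmaStepDefs` (`Sigma.Strategy`, `Strategy.cjs`, the σ-copies of the near-chain rows and their `Iff.rfl`
transports). OURS (cell res-hironaka, slot W4.2); NOT statements of H. Hironaka's manuscript [Hironaka2017] nor of [CossartJannsenSaito2020]
beyond the typed Rem. 6.29 (1); AI-drafted, weaker than expert review. Helper file `--supports stmt-ResolutionOfSingularities-19249`
(counted 0). Definitions + `rfl`-grade transport lemmas + two uniqueness ports; no row is claimed.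

## Why (k21)

The CJS label strategy of Rem. 6.29 (1), typed as `IsCanonicalStep R N ν` (Literature `…Resolution.CanonicalEliminationSequence` :313),
LOOPS at a never-isolated W-top crossing of the threefold `y³ + x₃⁵ + x₁⁶x₂⁶x₃` (plan-1 RULINGS v3.13-5: k21 CONFIRMED, combinatorial kernel
p516000); the oracle `R : ∀ S, CentreSeq S → Prop` of that step relation only PREPARES the abstract treated part `T` (centres over the
non-regular locus of `T`), so it cannot encode a centre choice that reads the threefold. The conjunct asks for ∃ a Σmax-eliminating
modification, not for the CJS strategy; the σ-layer re-types the rows over a strategy PARAMETER. This file types the sub-class in which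
the TOP-LEVEL DISCIPLINE of Rem. 6.29 (1) is kept VERBATIM (labels (6.5), least label first, resolution cycles, cycle end = blow up the
whole treated part) and only the IN-CYCLE JOB is parametrised: a STAGE ORACLE `ω` reads the stage `W`, its bookkeeping `L` and the
EMBEDDED treated part `φ : S ⟶ W`, and names the lower sequence `t : CentreSeq S` to be replayed — whence every label-bookkeeping theorem
of the tree (treated label, `support_eq_part_of_next_none`, the cycle package, L∞'s proof) keeps its shape over this class.

## Contents (namespace `…Theorems.SigmaMaxModificationsCorridor3.Sigma`, res-D-pv-047's)

* `StageOracle` (field `names`), `IsCanonicalStepΩ ω hW N ν L P C P'` (= `IsCanonicalStep` with the single token `R _ t` replaced by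
  `ω.names W hW N ν L _ φ t`), `StageOracle.lift R` and `isCanonicalStepΩ_lift_iff` (each case `Iff.rfl`): the CJS step IS the Ω-step of
  the lifted oracle.
* `Strategy.ofStageOracle ω : Strategy` with `Strategy.ofStageOracle_step_iff` (`Iff.rfl`) and
  `Strategy.cjs_eq_ofStageOracle_lift : Strategy.cjs R = Strategy.ofStageOracle (StageOracle.lift R)` — by `rfl`
  (the two pattern-matching definitions are definitionally equal), so every σ-row over `Strategy.cjs R` IS a row over the class.
* `OracleAdmissibleΩ ω` — THE RELAXATION of `OracleAdmissible` (…CampaignW42Tertiary :190 = `t.AllPermissible ∧ t.CentresOver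
  (regularLocus S)ᶜ ∧ IsRegular t.top`): the middle clause is DROPPED (in-cycle centres may sit anywhere in the treated part — e.g. at
  regular points of `T` singled out by the W-top structure of `W` —, not only over `Sing T`); «permissible for `S`» is KEPT (the cycle
  package's pending invariant uses it verbatim: a permissible centre swallows no irreducible component,
  `not_subset_image_support_of_isPermissible`) and so is «regular top» (the cycle-end centre is regular). HONEST CONSEQUENCE: «permissible
  for `S`» excludes naming a whole irreducible COMPONENT of `T` (CJS Def. 3.1 (2)), so at a crossing of two same-label `ν`-lines the
  freedom of this class is «which POINTS of `T`, how many times, before the END blows up both strict transforms» — not «one line first»;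
  a component-first / componentwise variant needs a different END rule (blow up the replayed subscheme's image `V(range φ)` instead of
  `V(part j)`, rebirths of a mid-cycle component centre waiting for the next cycle) whose transport to the CJS step is an `Iff` on states
  under the cycle invariant, not `Iff.rfl` — NOT typed here (plan-1's word after the engine test (BR)).
* `OracleFunctionalΩ ω`, the ports `IsCanonicalStepΩ.centre_unique` / `IsCanonicalStepΩ.pending_unique` / `IsCanonicalStepΩ.hsStratum_nonempty`,
  `Strategy.isFunctional_ofStageOracle` (functional ω ⇒ functional strategy, res-D-pv-047's `Strategy.IsFunctional`), and
  `oracleAdmissibleΩ_lift`, `oracleFunctionalΩ_lift`.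

References: CJS LNM 2270 Rem. 6.29 (1) pp. 91–92, Def. 3.1, Step 7 of the proof of Thm. 6.28 [CossartJannsenSaito2020]; tree
`Literature…CanonicalEliminationSequence` (`IsCanonicalStep`, `IsReplayStep`, `Pending`, `OracleFunctional`, `centre_unique`),
`…CampaignW42Tertiary` (`OracleAdmissible`), `…Corridor3SigmaStepDefs` (res-D-pv-047, part 1); HOME `L/w42/sigma_step_spec.md` 7a35e1b7614d46a8,
`plan/tools/res-type-040/V8b-sigma-feasibility.md` 2e2a7f87252ef67b; STATUS res-L1-w42-plan-1 RULINGS v3.14-6 (BQ) 09:36:02Z, res-type-040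
CUT 09:40:20Z.
-/

noncomputable section

set_option linter.dupNamespace false

open CategoryTheory AlgebraicGeometry TopologicalSpace
open Summit.ResolutionOfSingularities.ResolutionOfSingularities.Theorems.CampaignW42
open Literature.AlgebraicGeometry.Resolution Literature.RingTheory.HilbertSamuel

namespace Summit.ResolutionOfSingularities.ResolutionOfSingularities.Theorems.SigmaMaxModificationsCorridor3.Sigma

universe u

/-! ## §1. Stage oracles and the cycle-disciplined step `IsCanonicalStepΩ` -/

/-- [OURS · L1 W4.2] **A STAGE ORACLE**: at a stage `W` (locally Noetherian) with bookkeeping `L`, level `N`, value `ν`, and for a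
lower-dimensional scheme `S` EMBEDDED by `φ : S ⟶ W` (at a cycle start: the treated part `Y_n^{(j)}` with its reduced structure and its
closed immersion), it names the admissible lower sequences `t : CentreSeq S` to be replayed inside `W`. The CJS oracle
`R : ∀ S, CentreSeq S → Prop` is the stage oracle that ignores `W`, `L`, `N`, `ν` and `φ` (`StageOracle.lift`). OURS bookkeeping; NOT a
statement of the manuscript. [cite: CossartJannsenSaito2020, Rem. 6.29 (1)] -/
structure StageOracle : Type (u + 1) where
  /-- the lower sequences the oracle names on the embedded part `φ : S ⟶ W` of the stage `W` in the state `L`, at level `N`, value `ν` -/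
  names : ∀ (W : Scheme.{u}), IsLocallyNoetherian W → ℕ → (ℕ → ℕ) → Labelling W →
    ∀ (S : Scheme.{u}), (S ⟶ W) → CentreSeq S → Prop

/-- [OURS · L1 W4.2] **The CJS oracle as a stage oracle** (it reads only the abstract part and the sequence). [folklore] -/
def StageOracle.lift (R : ∀ S : Scheme.{u}, CentreSeq S → Prop) : StageOracle.{u} :=
  ⟨fun _ _ _ _ _ S _ t => R S t⟩

/-- Unfolding. [folklore] -/
@[simp] theorem StageOracle.lift_names (R : ∀ S : Scheme.{u}, CentreSeq S → Prop) (W : Scheme.{u})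
    (hW : IsLocallyNoetherian W) (N : ℕ) (ν : ℕ → ℕ) (L : Labelling W) (S : Scheme.{u}) (φ : S ⟶ W) (t : CentreSeq S) :
    (StageOracle.lift R).names W hW N ν L S φ t = R S t := rfl

variable {W : Scheme.{u}}

/-- [OURS · L1 W4.2] **ONE STEP OF THE CYCLE-DISCIPLINED SEQUENCE DRIVEN BY THE STAGE ORACLE `ω`** — Literature `IsCanonicalStep`
(CJS Rem. 6.29 (1); Step 7 of the proof of Thm. 6.28) VERBATIM with the single token «`R _ t`» replaced by «`ω.names W hW N ν L _ φ t`»: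
between cycles (`P = none`) a cycle STARTS — `j` is the least label with `Y_n^{(j)} ≠ ∅`, `T = Y_n^{(j)}` with its reduced structure,
`t` a sequence that `ω` names ON THE EMBEDDED PART `T ↪ W`, and the step is the first replay step for `(T ↪ W, t)` (so the centre is `T`
itself if `t` is empty and the push-forward of the first centre of `t` otherwise); inside a cycle (`P = some _`), while the `ν`-locus is
non-empty, it is the next replay step. NOT a statement of the manuscript. [cite: CossartJannsenSaito2020, Rem. 6.29 (1)] -/
def IsCanonicalStepΩ (ω : StageOracle.{u}) (hW : IsLocallyNoetherian W) (N : ℕ) (ν : ℕ → ℕ) (L : Labelling W) :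
    Option (Pending W) → (C : W.IdealSheafData) → Option (Pending (blowup C)) → Prop
  | none, C, P' =>
      ∃ j, IsLeast {i | (L.part (Scheme.hsStratum W N ν) i).Nonempty} j ∧
        ∃ h : IsClosed (L.part (Scheme.hsStratum W N ν) j),
          ∃ t : CentreSeq
              (Scheme.IdealSheafData.vanishingIdeal ⟨L.part (Scheme.hsStratum W N ν) j, h⟩).subscheme,
            ω.names W hW N ν L _
                (Scheme.IdealSheafData.vanishingIdeal ⟨L.part (Scheme.hsStratum W N ν) j, h⟩).subschemeι t ∧
              IsReplayStep L (Scheme.hsStratum W N ν) j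
                (Scheme.IdealSheafData.vanishingIdeal ⟨L.part (Scheme.hsStratum W N ν) j, h⟩).subschemeι t C P'
  | some P, C, P' =>
      (Scheme.hsStratum W N ν).Nonempty ∧ IsReplayStep L (Scheme.hsStratum W N ν) P.lbl P.hom P.rest C P'

/-- Unfolding: a step between cycles. [cite: CossartJannsenSaito2020, Rem. 6.29 (1)] -/
theorem isCanonicalStepΩ_none_iff (ω : StageOracle.{u}) (hW : IsLocallyNoetherian W) (N : ℕ) (ν : ℕ → ℕ) (L : Labelling W)
    (C : W.IdealSheafData) (P' : Option (Pending (blowup C))) :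
    IsCanonicalStepΩ ω hW N ν L none C P' ↔
      ∃ j, IsLeast {i | (L.part (Scheme.hsStratum W N ν) i).Nonempty} j ∧
        ∃ h : IsClosed (L.part (Scheme.hsStratum W N ν) j),
          ∃ t : CentreSeq
              (Scheme.IdealSheafData.vanishingIdeal ⟨L.part (Scheme.hsStratum W N ν) j, h⟩).subscheme,
            ω.names W hW N ν L _
                (Scheme.IdealSheafData.vanishingIdeal ⟨L.part (Scheme.hsStratum W N ν) j, h⟩).subschemeι t ∧
              IsReplayStep L (Scheme.hsStratum W N ν) j
                (Scheme.IdealSheafData.vanishingIdeal ⟨L.part (Scheme.hsStratum W N ν) j, h⟩).subschemeι t C P' :=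
  Iff.rfl

/-- Unfolding: a step inside a cycle. [cite: CossartJannsenSaito2020, Rem. 6.29 (1)] -/
theorem isCanonicalStepΩ_some_iff (ω : StageOracle.{u}) (hW : IsLocallyNoetherian W) (N : ℕ) (ν : ℕ → ℕ) (L : Labelling W)
    (P : Pending W) (C : W.IdealSheafData) (P' : Option (Pending (blowup C))) :
    IsCanonicalStepΩ ω hW N ν L (some P) C P' ↔
      (Scheme.hsStratum W N ν).Nonempty ∧ IsReplayStep L (Scheme.hsStratum W N ν) P.lbl P.hom P.rest C P' :=
  Iff.rfl

/-- **THE CJS STEP IS THE Ω-STEP OF THE LIFTED ORACLE** (each case `Iff.rfl`): the class of cycle-disciplined strategies contains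
`S(X, ν)` definitionally. [cite: CossartJannsenSaito2020, Rem. 6.29 (1)] -/
theorem isCanonicalStepΩ_lift_iff (R : ∀ S : Scheme.{u}, CentreSeq S → Prop) (hW : IsLocallyNoetherian W) (N : ℕ) (ν : ℕ → ℕ)
    (L : Labelling W) (P : Option (Pending W)) (C : W.IdealSheafData) (P' : Option (Pending (blowup C))) :
    IsCanonicalStepΩ (StageOracle.lift R) hW N ν L P C P' ↔ IsCanonicalStep R N ν L P C P' := by
  cases P with
  | none => exact Iff.rfl
  | some P => exact Iff.rfl

variable {ω : StageOracle.{u}} {hW : IsLocallyNoetherian W} {N : ℕ} {ν : ℕ → ℕ}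

/-- No Ω-step leaves a stage whose `ν`-stratum is empty (the procedure has ended there) — port of `IsCanonicalStep.hsStratum_nonempty`.
[cite: CossartJannsenSaito2020, Rem. 6.29 (1)] -/
theorem IsCanonicalStepΩ.hsStratum_nonempty {L : Labelling W} {P : Option (Pending W)} {C : W.IdealSheafData}
    {P' : Option (Pending (blowup C))} (h : IsCanonicalStepΩ ω hW N ν L P C P') : (Scheme.hsStratum W N ν).Nonempty := by
  cases P with
  | none =>
    obtain ⟨j, hj, -⟩ := h
    exact (L.exists_part_nonempty_iff _).mp ⟨j, hj.1⟩
  | some P => exact h.1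

/-! ## §2. Admissibility (the RELAXATION) and functionality of a stage oracle -/

/-- [OURS · L1 W4.2] **ADMISSIBLE STAGE ORACLE — the relaxation of `OracleAdmissible`.** Every sequence `t` that `ω` names on an embedded
part `φ : S ⟶ W` has PERMISSIBLE centres (CJS Def. 3.1, for the lower-dimensional tower on `S`) and a REGULAR last stage; the clause
«centres over the non-regular locus of `S`» of `OracleAdmissible` (…CampaignW42Tertiary) is DROPPED — in-cycle centres may sit anywhere
in the treated part, e.g. at regular points of `T` singled out by the structure of `W`. «Permissible for `S`» is kept because the cycle
package (`isCanonicalStep_cycle_package`) uses it verbatim (a permissible centre swallows no irreducible component of the part, so the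
replayed subscheme stays equal to the label-`j` part); it EXCLUDES naming a whole irreducible component of `T` as a centre (Def. 3.1 (2)).
NOT a statement of the manuscript. [cite: CossartJannsenSaito2020, Def. 3.1, Rem. 6.29 (1)] -/
def OracleAdmissibleΩ (ω : StageOracle.{u}) : Prop :=
  ∀ (W : Scheme.{u}) (hW : IsLocallyNoetherian W) (N : ℕ) (ν : ℕ → ℕ) (L : Labelling W) (S : Scheme.{u}) (φ : S ⟶ W)
    (t : CentreSeq S), ω.names W hW N ν L S φ t →
    t.AllPermissible ∧ Literature.AlgebraicGeometry.Resolution.Scheme.IsRegular t.top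

/-- [OURS · L1 W4.2] **FUNCTIONAL STAGE ORACLE**: `ω` names at most one sequence on each embedded part of each state (port of
`OracleFunctional`). [folklore] -/
def OracleFunctionalΩ (ω : StageOracle.{u}) : Prop :=
  ∀ (W : Scheme.{u}) (hW : IsLocallyNoetherian W) (N : ℕ) (ν : ℕ → ℕ) (L : Labelling W) (S : Scheme.{u}) (φ : S ⟶ W)
    (t₁ t₂ : CentreSeq S), ω.names W hW N ν L S φ t₁ → ω.names W hW N ν L S φ t₂ → t₁ = t₂

/-- An admissible CJS oracle lifts to an admissible stage oracle (the dropped clause is simply not used). [folklore] -/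
theorem oracleAdmissibleΩ_lift {R : ∀ S : Scheme.{u}, CentreSeq S → Prop} (hRa : OracleAdmissible R) :
    OracleAdmissibleΩ (StageOracle.lift R) :=
  fun _ _ _ _ _ S _ t ht => ⟨(hRa S t ht).1, (hRa S t ht).2.2⟩

/-- A functional CJS oracle lifts to a functional stage oracle. [folklore] -/
theorem oracleFunctionalΩ_lift {R : ∀ S : Scheme.{u}, CentreSeq S → Prop} (hRf : OracleFunctional R) :
    OracleFunctionalΩ (StageOracle.lift R) :=
  fun _ _ _ _ _ S _ t₁ t₂ h₁ h₂ => hRf S t₁ t₂ h₁ h₂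

/-- **For a functional stage oracle the Ω-step from a given state has a well-determined centre** (port of
`IsCanonicalStep.centre_unique`: the least non-empty label, the reduced structure on its part, the oracle's sequence and the push-forward
are all determined). [cite: CossartJannsenSaito2020, Rem. 6.29 (1)] -/
theorem IsCanonicalStepΩ.centre_unique (hω : OracleFunctionalΩ ω) {L : Labelling W} {P : Option (Pending W)}
    {C₁ C₂ : W.IdealSheafData} {P₁ : Option (Pending (blowup C₁))} {P₂ : Option (Pending (blowup C₂))}
    (h₁ : IsCanonicalStepΩ ω hW N ν L P C₁ P₁) (h₂ : IsCanonicalStepΩ ω hW N ν L P C₂ P₂) : C₁ = C₂ := by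
  cases P with
  | none =>
    obtain ⟨j₁, hj₁, hcl₁, t₁, hR₁, hs₁⟩ := h₁
    obtain ⟨j₂, hj₂, hcl₂, t₂, hR₂, hs₂⟩ := h₂
    obtain rfl : j₁ = j₂ := hj₁.unique hj₂
    obtain rfl : t₁ = t₂ := hω _ _ _ _ _ _ _ _ _ hR₁ hR₂
    exact hs₁.centre_unique hs₂
  | some P => exact IsReplayStep.centre_unique h₁.2 h₂.2

/-- … and a well-determined next state (port of `IsCanonicalStep.pending_unique`). [cite: CossartJannsenSaito2020, Rem. 6.29 (1)] -/
theorem IsCanonicalStepΩ.pending_unique (hω : OracleFunctionalΩ ω) {L : Labelling W} {P : Option (Pending W)}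
    {C : W.IdealSheafData} {P₁ P₂ : Option (Pending (blowup C))}
    (h₁ : IsCanonicalStepΩ ω hW N ν L P C P₁) (h₂ : IsCanonicalStepΩ ω hW N ν L P C P₂) : P₁ = P₂ := by
  cases P with
  | none =>
    obtain ⟨j₁, hj₁, hcl₁, t₁, hR₁, hs₁⟩ := h₁
    obtain ⟨j₂, hj₂, hcl₂, t₂, hR₂, hs₂⟩ := h₂
    obtain rfl : j₁ = j₂ := hj₁.unique hj₂
    obtain rfl : t₁ = t₂ := hω _ _ _ _ _ _ _ _ _ hR₁ hR₂
    exact hs₁.pending_unique hs₂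
  | some P =>
    haveI := P.isClosedImmersion
    exact IsReplayStep.pending_unique h₁.2 h₂.2

/-! ## §3. The cycle-disciplined strategies inside res-D-pv-047's `Sigma.Strategy` -/

/-- [OURS · L1 W4.2] **THE STRATEGY OF A STAGE ORACLE** (SHAPE (3) of res-type-040's V8-b′ memo: top-level label / cycle discipline of
Rem. 6.29 (1) verbatim, in-cycle job by `ω`). NOT a statement of the manuscript. [cite: CossartJannsenSaito2020, Rem. 6.29 (1)] -/
def Strategy.ofStageOracle (ω : StageOracle.{u}) : Strategy.{u} :=
  ⟨fun _ hW N ν L P C P' => IsCanonicalStepΩ ω hW N ν L P C P'⟩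

/-- Unfolding (`Iff.rfl`). [folklore] -/
theorem Strategy.ofStageOracle_step_iff (ω : StageOracle.{u}) (W : Scheme.{u}) (hW : IsLocallyNoetherian W) (N : ℕ) (ν : ℕ → ℕ)
    (L : Labelling W) (P : Option (Pending W)) (C : W.IdealSheafData) (P' : Option (Pending (blowup C))) :
    (Strategy.ofStageOracle ω).step W hW N ν L P C P' ↔ IsCanonicalStepΩ ω hW N ν L P C P' :=
  Iff.rfl

/-- **The CJS strategy is the strategy of the lifted CJS oracle** (`Strategy.cjs R = Strategy.ofStageOracle (StageOracle.lift R)`):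
every row over `Strategy.cjs R` is a row over the cycle-disciplined class. [cite: CossartJannsenSaito2020, Rem. 6.29 (1)] -/
theorem Strategy.cjs_eq_ofStageOracle_lift (R : ∀ S : Scheme.{u}, CentreSeq S → Prop) :
    Strategy.cjs R = Strategy.ofStageOracle (StageOracle.lift R) :=
  rfl

/-- The step relations agree pointwise (the form the σ-transports use). [folklore] -/
theorem Strategy.cjs_step_iff_ofStageOracle_lift (R : ∀ S : Scheme.{u}, CentreSeq S → Prop) (W : Scheme.{u})
    (hW : IsLocallyNoetherian W) (N : ℕ) (ν : ℕ → ℕ) (L : Labelling W) (P : Option (Pending W)) (C : W.IdealSheafData)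
    (P' : Option (Pending (blowup C))) :
    (Strategy.cjs R).step W hW N ν L P C P' ↔ (Strategy.ofStageOracle (StageOracle.lift R)).step W hW N ν L P C P' :=
  Iff.rfl

/-- **The strategy of a FUNCTIONAL stage oracle is functional** in res-D-pv-047's sense (`Strategy.IsFunctional`, p519751) — by the two
uniqueness ports; so the compactness / near-chain extraction theorems that need a well-determined step apply to the whole
cycle-disciplined class. [cite: CossartJannsenSaito2020, Rem. 6.29 (1)] -/
theorem Strategy.isFunctional_ofStageOracle {ω : StageOracle.{u}} (hω : OracleFunctionalΩ ω) (N : ℕ) (ν : ℕ → ℕ) :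
    (Strategy.ofStageOracle ω).IsFunctional N ν :=
  fun _ _ _ _ =>
    ⟨fun _ _ _ _ h₁ h₂ => IsCanonicalStepΩ.centre_unique hω h₁ h₂,
      fun _ _ _ h₁ h₂ => IsCanonicalStepΩ.pending_unique hω h₁ h₂⟩

end Summit.ResolutionOfSingularities.ResolutionOfSingularities.Theorems.SigmaMaxModificationsCorridor3.Sigma

end
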